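import Mathlib
import Summits.ValiantsHypothesis.ValiantsHypothesis.Theses.FreeSubtorus
import Summits.ValiantsHypothesis.ValiantsHypothesis.Theorems.FreeSubtorusSubtorusCovering
import Summits.ValiantsHypothesis.ValiantsHypothesis.Cruxes.OrbitDimensionBound.Lines.PiecewiseLadder
import Literature.Computability.AlgebraicComplexity.DeterminantalComplexityProofs
import Literature.Computability.AlgebraicComplexity.EquivariantDC
import Summits.ValiantsHypothesis.ValiantsHypothesis.Theorems.FreeSubtorusOrbitDimensionBoundStubPieceSacrifice

/-!
# Line `piecewise_covering` — skeleton for the forward rung `Piecewise.PiecewiseCovering` / `Piecewise.PieceShadow`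
(crux `FreeSubtorus.OrbitDimensionBound`, stmt-ValiantsHypothesis-16133; unit `fwd2-rung-ValiantsHypothesis-01-g4`)

THE RUNG (numeric form, `Lines/PiecewiseLadder.lean`): for `n ≥ 3`, `Λ` admissible with `r` generators, every
PIECEWISE-`T_Λ`-equivariant decomposition `per_n = det B₁ + ⋯ + det B_k` (each `B_i` an exactly `T_Λ`-equivariant
affine matrix of size `m`) has `C(n,⌊n/2⌋) ≤ k · m · 2^r`.  `k = 1` is the proved floor `SubtorusCovering`.

TWO REGISTERED STUBS (the only sorries) and the kernel-checked composition `PiecewiseCovering_of`: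

* `stub_pieceSacrifice` (size M; the floor's OWN reduction run piecewise).  The floor's proof
  (`Theorems/FreeSubtorusSubtorusCovering.lean`, line `pair-sacrifice`) never uses `det B = per_n` inside its
  reduction steps: a maximum `ℚ`-independent matching in `Λ` (`stub_indepMatching`, LANDED, statement about `Λ`
  only) has `s ≤ r` pairs; either `n ≤ s + 2 ≤ r + 2`, or relabelling (`stub_relabel`) and the substitution
  `x_{(n'+j,n'+j)} = 1`, `0` elsewhere on the sacrificed lines (`stub_substPer`: `aeval g per_n = per_{n'}`, LANDED;
  `stub_substLifts`: exact lifts of the FULL two-sided torus of the `n' = n - s` surviving lines, via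
  `stub_torusExtension`, LANDED) turn the representation into a full-torus-equivariant one of `per_{n'}` of the same
  size.  Applied to each piece `B_i` (same `Λ`, same matching, same substitution `g`; `aeval g` is additive, so
  `∑ aeval g (det B_i) = aeval g per_n = per_{n'}`) it turns a piecewise `T_Λ`-decomposition of `per_n` into a
  piecewise FULL-TORUS decomposition of `per_{n'}` with the same `k` and `m`, `n' ≥ 3`, `n - n' ≤ r`.  What must be
  re-run: `stub_relabel` / `stub_substLifts` are stated for representations OF `per_n`; their proofs use only the
  affine entries and the lifts, so they transfer verbatim to a piece `det B_i = P_i`.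
* `stub_piecewiseTorusBound` (size L+; NEW — the load-bearing core, "piecewise Landsberg–Ressayre"): for `n ≥ 3`,
  `per_n = ∑_{i<k} det B_i` with every `B_i` affine of size `m` and exactly equivariant under the full two-sided torus
  `x ↦ D₁ x D₂` forces `C(n,⌊n/2⌋) ≤ k · m`.  `k = 1` is the LANDED `TorusBound` (`2^n - 1 ≤ m`, LR17 Thm. 2.8 /
  Grenet optimal; `Lines/piecewise_covering_special.lean (c)`); `m = n` is a Pólya–Marcus–Minc statement for SUMS
  ("`per_n` is not a sum of fewer than `C(n,⌊n/2⌋)/n` Hadamard-twisted determinants `det(M_j ∘ X)`"; `k = 1, m = n` is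
  Pólya 1913 / Marcus–Minc 1961).  Regular pieces (`corank B_i(x₀) ≤ 1` everywhere): the `TorusBound` engine runs
  piece by piece — every permutation monomial is SERVED at every level by the piece that carries it
  (`∑_i coeff_σ det B_i = 1`), level-`t` weights needed across the pieces `≥ C(n,t)`, so even `2^n - 1 ≤ ∑ m_i`.
  Irregular pieces (`corank c ≥ 2`: e.g. `det X` itself, Hadamard pieces `det(M ∘ X)`, block pieces
  `det [[per(R₁×C₁), per(R₁×C₁')],[per(R₂×C₂'), per(R₂×C₂)]]`) have `c`-tuples of anchored paths
  (Lindström–Gessel–Viennot) and FULL permutation support is cheap for them (`det X`: size `n`, support `n!`) — so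
  no coefficient-blind (support / monomial-set) argument can prove the stub (Aravind–Joglekar 2015 §1: monotone,
  Nisan-rank and partial-derivative bounds are insensitive to coefficients and `mon(per_n)` is a read-once
  determinant); the count must use the SIGNS, i.e. be a Pólya–Gibson-type obstruction for sums.  Cheapest falsifier:
  `n = 6, m = 6, k = 3, r = 0` — is `per_6 = det(M₁∘X) + det(M₂∘X) + det(M₃∘X)` solvable over `ℂ` (720 equations, 108
  unknowns)?  (kit job j044865, damped Gauss–Newton; see the line card.)

Composition: `(n ≤ r + 2)`-branch by the floor's arithmetic (`C(n,⌊n/2⌋) ≤ 2^{n-1} ≤ n 2^{n-2} ≤ m 2^r`, `n ≤ m` by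
degrees); main branch `C(n'+s, ⌊(n'+s)/2⌋) ≤ 2^s C(n',⌊n'/2⌋) ≤ 2^s k m ≤ k m 2^r` (the middle binomial at most
doubles per step — proved here).

Disproof used (`Cruxes/OrbitDimensionBound/Disproof.lean`): its theorems concern the SYMMETRISATION crux
(`orbitDimensionBound_false_without_repHyp`; §4 in-place refutations `not_inPlaceHomothety`,
`not_orbitDimensionBoundInPlace`; §5 `orbitDimensionBoundR0_iff_grenetOptimal`).  This line's relaxed target
`Piecewise.OrbitPieceBound` asks for NEW matrices `B_i` (not in place) and keeps the representation hypothesis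
(`∑ det B_i = per_n` exactly — no junk, no scalar), so it honours `_false_without_repHyp`; no `-- Targets` stub of the
Disproof is instantiated (every stub here quantifies over piecewise data, `k` free).
[cite: LandsbergRessayre2017, Thm. 2.8, §6, Question 2.2] [cite: IkenmeyerLandsberg2017, Def. 2.8, Thm. 2.9]
[cite: Vonzurgathen1987, Thm. 3.1]
-/

set_option linter.dupNamespace false
set_option linter.unusedVariables false

noncomputable section

namespace Summit.ValiantsHypothesis.ValiantsHypothesis.Cruxes.OrbitDimensionBound.Piecewise.Line

open MvPolynomial
open Literature.Computability.AlgebraicComplexity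
open Summit.ValiantsHypothesis.ValiantsHypothesis.Cruxes.OrbitDimensionBound.Piecewise

/-! ## §0 Vocabulary: the full two-sided torus, piecewise full-torus decompositions -/

/-- The full two-sided torus `{diag(d_k e_l)} ≤ GL_{n²}(ℂ)` — VERBATIM the generating set of the landed
`RigidityForcesSymmetry.TorusBound`. [cite: LandsbergRessayre2017, Thm. 2.8] -/
def fullTorus (n : ℕ) : Subgroup (GL (Fin n × Fin n) ℂ) :=
  Subgroup.closure {γ : GL (Fin n × Fin n) ℂ | ∃ d e : Fin n → ℂ,
    (γ : Matrix (Fin n × Fin n) (Fin n × Fin n) ℂ) = Matrix.diagonal (fun p => d p.1 * e p.2)}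

/-- Piecewise FULL-TORUS decomposition of `per_n`: `k` pieces of size `m`, each exactly equivariant under the full
two-sided torus. [cite: IkenmeyerLandsberg2017, Def. 2.8] -/
def IsPiecewiseTorusRepr (n k m : ℕ) (P : Fin k → MvPolynomial (Fin n × Fin n) ℂ)
    (B : Fin k → Matrix (Fin m) (Fin m) (MvPolynomial (Fin n × Fin n) ℂ)) : Prop :=
  (∑ i, P i) = perPoly (Fin n) ℂ ∧ ∀ i, IsEquivariantDetRepr (fullTorus n) (P i) (B i)

/-! ## §1 Statements of the stubs -/

/-- Statement of stub 1 (`stub_pieceSacrifice`): the floor's pair-sacrifice reduction, run piecewise — either the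
ranks are degenerate (`n ≤ r + 2`) or the decomposition descends to a piecewise FULL-torus decomposition of
`per_{n'}`, `n' ≥ 3`, `n - n' ≤ r`, same `k`, same `m`. [cite: LandsbergRessayre2017, §6] -/
def Stmt.stub_pieceSacrifice : Prop :=
  ∀ (n k m r : ℕ) (Λ : Fin r → (Fin n ⊕ Fin n) → ℤ) (P : Fin k → MvPolynomial (Fin n × Fin n) ℂ)
    (B : Fin k → Matrix (Fin m) (Fin m) (MvPolynomial (Fin n × Fin n) ℂ)),
    3 ≤ n → Admissible n r Λ → IsPiecewiseRepr n k m r Λ P B →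
    n ≤ r + 2 ∨
      ∃ (s n' : ℕ), s ≤ r ∧ n = n' + s ∧ 3 ≤ n' ∧
        ∃ (P' : Fin k → MvPolynomial (Fin n' × Fin n') ℂ)
          (B' : Fin k → Matrix (Fin m) (Fin m) (MvPolynomial (Fin n' × Fin n') ℂ)),
          IsPiecewiseTorusRepr n' k m P' B'

/-- Statement of stub 2 (`stub_piecewiseTorusBound`) — **piecewise Landsberg–Ressayre** (the open core): a
piecewise full-torus decomposition of `per_n` (`n ≥ 3`) with `k` pieces of size `m` has `C(n,⌊n/2⌋) ≤ k · m`.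
[cite: LandsbergRessayre2017, Thm. 2.8, Question 2.2] [cite: IkenmeyerLandsberg2017, Thm. 2.9] -/
def Stmt.stub_piecewiseTorusBound : Prop :=
  ∀ (n k m : ℕ) (P : Fin k → MvPolynomial (Fin n × Fin n) ℂ)
    (B : Fin k → Matrix (Fin m) (Fin m) (MvPolynomial (Fin n × Fin n) ℂ)),
    3 ≤ n → IsPiecewiseTorusRepr n k m P B → Nat.choose n (n / 2) ≤ k * m

/-! ## §2 Registered stubs (the ONLY sorries of this file) -/

/-- **Registered stub 1 = `Stmt.stub_pieceSacrifice`** (size M: re-run `stub_relabel` / `stub_substLifts` for a piece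
`det B_i = P_i` and sum `aeval g` over the pieces; `stub_indepMatching`, `stub_substPer`, `stub_torusExtension`
landed verbatim). [cite: LandsbergRessayre2017, §6] -/
theorem stub_pieceSacrifice : Stmt.stub_pieceSacrifice :=
  -- LANDED (p594275, val-lit-p7 g10); closed by name — wired 2026-08-28 by val-width-16133-w1 g2
  Summit.ValiantsHypothesis.ValiantsHypothesis.Theorems.FreeSubtorusOrbitDimensionBound.stub_pieceSacrifice

/-- **Registered stub 2 = `Stmt.stub_piecewiseTorusBound`** (size L+; NEW). [cite: LandsbergRessayre2017, Question 2.2] -/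
theorem stub_piecewiseTorusBound : Stmt.stub_piecewiseTorusBound := by
  sorry

/-! ## §3 Glue (proved): degrees, the middle binomial at most doubles -/

/-- A piecewise decomposition of `per_n` has pieces of size `≥ n` (`deg per_n = n`, `deg det B_i ≤ m`). [folklore] -/
theorem size_ge {n k m r : ℕ} {Λ : Fin r → (Fin n ⊕ Fin n) → ℤ}
    {P : Fin k → MvPolynomial (Fin n × Fin n) ℂ}
    {B : Fin k → Matrix (Fin m) (Fin m) (MvPolynomial (Fin n × Fin n) ℂ)}
    (h : IsPiecewiseRepr n k m r Λ P B) : n ≤ m := by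
  obtain ⟨hsum, hB⟩ := h
  have hdeg : (perPoly (Fin n) ℂ).totalDegree ≤ m := by
    rw [← hsum]
    refine (totalDegree_finsetSum _ _).trans (Finset.sup_le fun i _ => ?_)
    exact totalDegree_le_of_hasDetRepr_holds (k := ℂ) (σ := Fin n × Fin n) ⟨B i, (hB i).1⟩
  rwa [totalDegree_perPoly] at hdeg

/-- `C(N+1, ⌊(N+1)/2⌋) ≤ 2 · C(N, ⌊N/2⌋)`. [folklore] -/
theorem choose_middle_succ_le (N : ℕ) : (N + 1).choose ((N + 1) / 2) ≤ 2 * N.choose (N / 2) := by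
  rcases Nat.eq_zero_or_pos ((N + 1) / 2) with h0 | hpos
  · have hN : N = 0 := by omega
    subst hN
    simp
  · obtain ⟨K, hK⟩ : ∃ K, (N + 1) / 2 = K + 1 := ⟨(N + 1) / 2 - 1, by omega⟩
    rw [hK, Nat.choose_succ_succ', two_mul]
    exact Nat.add_le_add (Nat.choose_le_middle K N) (Nat.choose_le_middle (K + 1) N)

/-- `C(N+s, ⌊(N+s)/2⌋) ≤ 2^s · C(N, ⌊N/2⌋)`. [folklore] -/
theorem choose_middle_add_le (N s : ℕ) : (N + s).choose ((N + s) / 2) ≤ 2 ^ s * N.choose (N / 2) := by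
  induction s with
  | zero => simp
  | succ s ih =>
    calc (N + (s + 1)).choose ((N + (s + 1)) / 2) = (N + s + 1).choose ((N + s + 1) / 2) := by
          rw [← Nat.add_assoc]
      _ ≤ 2 * (N + s).choose ((N + s) / 2) := choose_middle_succ_le (N + s)
      _ ≤ 2 * (2 ^ s * N.choose (N / 2)) := Nat.mul_le_mul_left _ ih
      _ = 2 ^ (s + 1) * N.choose (N / 2) := by ring

/-! ## §4 The composition: stubs ⇒ the numeric rung ⇒ the rung declaration (kernel-checked, no sorry here) -/

/-- **`PiecewiseCovering_of`**: the two stubs imply the numeric rung `Piecewise.PiecewiseCovering`. -/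
theorem PiecewiseCovering_of :
    Stmt.stub_pieceSacrifice → Stmt.stub_piecewiseTorusBound →
      Summit.ValiantsHypothesis.ValiantsHypothesis.Cruxes.OrbitDimensionBound.Piecewise.PiecewiseCovering := by
  intro h₁ h₂ k n hn m r Λ P B hΛ hPB
  have hk : 1 ≤ k := one_le_pieces (by omega) hPB
  have hnm : n ≤ m := size_ge hPB
  rcases h₁ n k m r Λ P B hn hΛ hPB with hdeg | ⟨s, n', hs, rfl, hn', P', B', hPB'⟩
  · -- degenerate ranks: `r ≥ n - 2`, `m ≥ n ≥ 3`
    calc n.choose (n / 2) ≤ 2 ^ (n - 1) :=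
          Summit.ValiantsHypothesis.ValiantsHypothesis.Theorems.FreeSubtorusSubtorusCovering.choose_middle_le_two_pow_pred
            n (by omega)
      _ = 2 * 2 ^ (n - 2) := by rw [← pow_succ']; congr 1; omega
      _ ≤ n * 2 ^ (n - 2) := Nat.mul_le_mul_right _ (by omega)
      _ ≤ m * 2 ^ r := Nat.mul_le_mul hnm (Nat.pow_le_pow_right (by norm_num) (by omega))
      _ = 1 * m * 2 ^ r := by ring
      _ ≤ k * m * 2 ^ r := by gcongr
  · -- main branch: piecewise TorusBound for `per_{n'}`, then `C(n'+s,·) ≤ 2^s C(n',·)`, `s ≤ r`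
    have h := h₂ n' k m P' B' hn' hPB'
    calc (n' + s).choose ((n' + s) / 2) ≤ 2 ^ s * n'.choose (n' / 2) := choose_middle_add_le n' s
      _ ≤ 2 ^ s * (k * m) := Nat.mul_le_mul_left _ h
      _ ≤ 2 ^ r * (k * m) := Nat.mul_le_mul_right _ (Nat.pow_le_pow_right (by norm_num) hs)
      _ = k * m * 2 ^ r := by ring

/-- **`PieceShadow_of`**: the stubs imply the RUNG DECLARATION `Piecewise.PieceShadow` (via the ladder's
`pieceShadow_of_piecewiseCovering`). -/
theorem PieceShadow_of :
    Stmt.stub_pieceSacrifice → Stmt.stub_piecewiseTorusBound →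
      Summit.ValiantsHypothesis.ValiantsHypothesis.Cruxes.OrbitDimensionBound.Piecewise.PieceShadow :=
  fun h₁ h₂ => pieceShadow_of_piecewiseCovering (PiecewiseCovering_of h₁ h₂)

/-- **THE SKELETON: the rung declaration modulo exactly the two registered stubs.** -/
theorem PieceShadow_proof :
    Summit.ValiantsHypothesis.ValiantsHypothesis.Cruxes.OrbitDimensionBound.Piecewise.PieceShadow :=
  PieceShadow_of stub_pieceSacrifice stub_piecewiseTorusBound

/-- The numeric rung modulo the stubs. -/
theorem PiecewiseCovering_proof :
    Summit.ValiantsHypothesis.ValiantsHypothesis.Cruxes.OrbitDimensionBound.Piecewise.PiecewiseCovering :=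
  PiecewiseCovering_of stub_pieceSacrifice stub_piecewiseTorusBound

/-- For the record: the stubs re-prove the floor (`k = 1`). -/
theorem floor_of_stubs (h₁ : Stmt.stub_pieceSacrifice) (h₂ : Stmt.stub_piecewiseTorusBound) :
    Summit.ValiantsHypothesis.ValiantsHypothesis.Theses.FreeSubtorus.SubtorusCovering :=
  subtorusCovering_of_piecewiseCovering (PiecewiseCovering_of h₁ h₂)

/-- For the record: with the relaxed symmetrisation target the stubs decide the summit. -/
theorem vh_of_orbitPieceBound_of_stubs (h₀ : OrbitPieceBound) (h₁ : Stmt.stub_pieceSacrifice)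
    (h₂ : Stmt.stub_piecewiseTorusBound) : _root_.ValiantsHypothesis :=
  closes_piecewise h₀ (PiecewiseCovering_of h₁ h₂)

end Summit.ValiantsHypothesis.ValiantsHypothesis.Cruxes.OrbitDimensionBound.Piecewise.Line

end
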